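import Summits.QuantumFields.YangMills.Theorems.VirialFluxGapResolventFieldCoefficients
import HarnessLib

/-!
# Route `VirialFluxGap` (YangMills): the RESOLVENT EULER FIELD — the VALUE OF ITS FRAME DIVERGENCE at a ring history

Toward the deciding crux `VirialFluxGap.PeriodicSoftness` (item stmt-QuantumFields-24141), generic-region Euler field (memo v2, step (D)).
For the cut-off resolvent coefficients `φ_j = resolventCoeff τ λ⋆ χ j` (✓`contDiff_resolventCoeff`) this file computes the frame derivative of
`φ_j` along `τ_i` at a ring history `P` and the DIVERGENCE `Σ_j ∂_{τ_j} φ_j`: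

* §1 `hasDerivAt_resolvent_coeff_of_det` — the one-variable resolvent calculus of ✓`ResolventField.hasDerivAt_resolvent_coeff` under the weaker
  hypothesis `det(H(s₀) + λ⋆) ≠ 0` (no floor);
* §2 ★★ `frameD_resolventCoeff` — `∂_{τ_i}φ_j(P) = ∂_{τ_i}χ·½(A⁻¹g)_j + χ·½[(A⁻¹Ĥ_{i·})_j − (A⁻¹B_iA⁻¹g)_j]` with `B_i = ∂_{τ_i}H` (entrywise),
  `Ĥ_{i·}` the `i`-th row of the raw Hessian (`= ∂_{τ_i} g`);
* §3 ★★★ `sum_frameD_resolventCoeff` — `Σ_j ∂_{τ_j}φ_j(P) = Σ_j ∂_{τ_j}χ·½(A⁻¹g)_j + χ·(½tr(A⁻¹H) − ½Σ_j(A⁻¹B_jA⁻¹g)_j)`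
  (✓`ResolventField.sum_deriv_resolvent_coeff` with the antisymmetric part `N = Ĥ − H`), and `frameD_resolventCoeff_eq_zero_of_notMem` — the
  divergence VANISHES off `tsupport χ`.  With ✓`generic_divergence_upper` this is clause (ii) of «EulerField» for `X_g` wherever `∂χ = 0`.

HONEST FRAMING: plumbing; the cut-off terms `Σ_j ∂_jχ·½(A⁻¹g)_j` (sign-controlled for `χ = χ₁(F₀/t₀)`, patching for the central charts) and the
assembly are NOT here; ⟨24141⟩ stays OPEN; no stub / crux / rung / summit is closed; the Yang–Mills mass gap is NOT proved; no summit is proved by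
a line.  THEOREMS ONLY (0 `def`, 0 `sorry`), standard axioms.  Explicit-unit seat `ym-line-fcl-p3` g40 (cell ym-idea-1, free hands),
`--supports stmt-QuantumFields-24141`.  References: [folklore].
-/

set_option autoImplicit false

noncomputable section

open scoped Matrix BigOperators ContDiff Topology
open MeasureTheory Set Matrix
open Literature.MathematicalPhysics.QuantumFieldTheory hiding SU2
open Literature.MathematicalPhysics.QuantumLattice
open Literature.MathematicalPhysics.QuantumFieldTheory.SUNBakryEmery (expSU coe_expSU matTop)

namespace Summit.QuantumFields.YangMills.Theorems.VirialFluxGap.FrameHessian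

open Summit.QuantumFields.YangMills.Theorems.FemtoTransferGap
open Summit.QuantumFields.YangMills.Theorems.FemtoTransferGap.TT
open Summit.QuantumFields.YangMills.Theorems.VirialFluxGap.RingDeficit
open Summit.QuantumFields.YangMills.Theorems.VirialFluxGap.FrameDerivative
open Summit.QuantumFields.YangMills.Theorems.VirialFluxGap.ResolventField

/-! ## §1 One-variable resolvent calculus under `det ≠ 0` -/

/-- The resolvent coefficient along a curve, under `det(H(s₀) + λ⋆) ≠ 0` only (cf. ✓`hasDerivAt_resolvent_coeff`, which assumed a floor).
[folklore] -/
theorem hasDerivAt_resolvent_coeff_of_det {ι : Type*} [Fintype ι] [DecidableEq ι] {Hs : ℝ → Matrix ι ι ℝ} {H' : Matrix ι ι ℝ}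
    {gs : ℝ → ι → ℝ} {g' : ι → ℝ} {s₀ lam : ℝ}
    (hH : ∀ j k, HasDerivAt (fun s => Hs s j k) (H' j k) s₀) (hg : ∀ k, HasDerivAt (fun s => gs s k) (g' k) s₀)
    (hdet : (Hs s₀ + lam • (1 : Matrix ι ι ℝ)).det ≠ 0) (j : ι) :
    HasDerivAt (fun s => (1 / 2 : ℝ) * (((Hs s + lam • (1 : Matrix ι ι ℝ))⁻¹ *ᵥ gs s) j))
      ((1 / 2 : ℝ) * ((((Hs s₀ + lam • (1 : Matrix ι ι ℝ))⁻¹ *ᵥ g') j) -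
        (((Hs s₀ + lam • (1 : Matrix ι ι ℝ))⁻¹ *ᵥ (H' *ᵥ ((Hs s₀ + lam • (1 : Matrix ι ι ℝ))⁻¹ *ᵥ gs s₀))) j))) s₀ := by
  set As : ℝ → Matrix ι ι ℝ := fun s => Hs s + lam • (1 : Matrix ι ι ℝ) with hAs
  have hA : ∀ j k, HasDerivAt (fun s => As s j k) (H' j k) s₀ := by
    intro j k
    have : (fun s => As s j k) = fun s => Hs s j k + lam * (1 : Matrix ι ι ℝ) j k := by
      funext s; simp [hAs, Matrix.add_apply, Matrix.smul_apply]
    rw [this]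
    simpa using (hH j k).add_const (lam * (1 : Matrix ι ι ℝ) j k)
  have hinv := hasDerivAt_inv_entry hA hdet
  have hφ : HasDerivAt (fun s => ((As s)⁻¹ *ᵥ gs s) j)
      (∑ k, ((-((As s₀)⁻¹ * H' * (As s₀)⁻¹)) j k * gs s₀ k + (As s₀)⁻¹ j k * g' k)) s₀ := by
    have : (fun s => ((As s)⁻¹ *ᵥ gs s) j) = fun s => ∑ k, (As s)⁻¹ j k * gs s k := by
      funext s; rfl
    rw [this]
    exact HasDerivAt.fun_sum fun k _ => (hinv j k).mul (hg k)
  have hval : ∑ k, ((-((As s₀)⁻¹ * H' * (As s₀)⁻¹)) j k * gs s₀ k + (As s₀)⁻¹ j k * g' k) =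
      ((As s₀)⁻¹ *ᵥ g') j - ((As s₀)⁻¹ *ᵥ (H' *ᵥ ((As s₀)⁻¹ *ᵥ gs s₀))) j := by
    rw [Finset.sum_add_distrib]
    have e1 : ∑ k, (-((As s₀)⁻¹ * H' * (As s₀)⁻¹)) j k * gs s₀ k = -(((As s₀)⁻¹ *ᵥ (H' *ᵥ ((As s₀)⁻¹ *ᵥ gs s₀))) j) := by
      rw [Matrix.mulVec_mulVec, Matrix.mulVec_mulVec, Matrix.mul_assoc]
      simp only [Matrix.neg_apply, neg_mul, Finset.sum_neg_distrib, Matrix.mulVec, dotProduct, ← Matrix.mul_assoc]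
    have e2 : ∑ k, (As s₀)⁻¹ j k * g' k = ((As s₀)⁻¹ *ᵥ g') j := rfl
    rw [e1, e2]; ring
  rw [hval] at hφ
  exact hφ.const_mul (1 / 2 : ℝ)

/-! ## §2 The frame derivative of the coefficients at a ring history -/

variable {L : ℕ} [NeZero L]
variable {ι : Type*} [Fintype ι] [DecidableEq ι]

open scoped Matrix.Norms.Frobenius

attribute [local instance 2000] Literature.MathematicalPhysics.QuantumFieldTheory.SUNBakryEmery.matTop

/-- The frame derivative of a smooth function of the coordinates at a ring history is the derivative along the multi-direction curve:
uniqueness form. [folklore] -/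
theorem frameD_eq_of_hasDerivAt {f : ((Fin (2 * L - 1 + 1) → Edge 3 L → Matrix (Fin 2) (Fin 2) ℂ) × (Site 3 L → Matrix (Fin 2) (Fin 2) ℂ)) → ℝ} (hf : ContDiff ℝ ∞ f) (Y : ((Fin (2 * L - 1 + 1) × Edge 3 L) ⊕ Site 3 L) → Matrix (Fin 2) (Fin 2) ℂ) (hY : ∀ w, (Y w)ᴴ = -Y w)
    (hY0 : ∀ w, (Y w).trace = 0) (P : ((Fin (2 * L - 1 + 1) → GaugeConfig 3 L SU2) × (Site 3 L → SU2))) {d : ℝ} (hd : HasDerivAt (fun s => f (ringCoord L (P * multiCurve Y hY hY0 s))) d 0) :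
    frameD Y f (ringCoord L P) = d := by
  have h := hasDerivAt_comp_multiCurve hf Y hY hY0 P 0
  rw [multiCurve_zero, mul_one] at h
  exact h.unique hd

/-- ★★ **The frame derivative of the cut-off resolvent coefficients at a ring history.**  With `M = ringCoord P`, `A = H(M) + λ⋆`, `g`, `Ĥ`, `H`
the frame gradient ∕ raw ∕ symmetrised Hessians and `B = ∂_Y H` entrywise:
`∂_Y φ_j(M) = ∂_Yχ(M)·½(A⁻¹g)_j + χ(M)·½[(A⁻¹(∂_Y g))_j − (A⁻¹BA⁻¹g)_j]` (provided `det A ≠ 0` and `χ` is an admissible cut-off). [folklore] -/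
theorem frameD_resolventCoeff (τ : ι → ((Fin (2 * L - 1 + 1) × Edge 3 L) ⊕ Site 3 L) → Matrix (Fin 2) (Fin 2) ℂ) (lam : ℝ) {χ : ((Fin (2 * L - 1 + 1) → Edge 3 L → Matrix (Fin 2) (Fin 2) ℂ) × (Site 3 L → Matrix (Fin 2) (Fin 2) ℂ)) → ℝ} (hχ : ContDiff ℝ ∞ χ)
    (hsupp : tsupport χ ⊆ {M : ((Fin (2 * L - 1 + 1) → Edge 3 L → Matrix (Fin 2) (Fin 2) ℂ) × (Site 3 L → Matrix (Fin 2) (Fin 2) ℂ)) | (frameHess (L := L) τ M + lam • (1 : Matrix ι ι ℝ)).det ≠ 0})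
    (Y : ((Fin (2 * L - 1 + 1) × Edge 3 L) ⊕ Site 3 L) → Matrix (Fin 2) (Fin 2) ℂ) (hY : ∀ w, (Y w)ᴴ = -Y w) (hY0 : ∀ w, (Y w).trace = 0) (P : ((Fin (2 * L - 1 + 1) → GaugeConfig 3 L SU2) × (Site 3 L → SU2)))
    (hdet : (frameHess (L := L) τ (ringCoord L P) + lam • (1 : Matrix ι ι ℝ)).det ≠ 0) (j : ι) :
    frameD Y (resolventCoeff (L := L) τ lam χ j) (ringCoord L P) =
      frameD Y χ (ringCoord L P) * ((1 / 2) * (((frameHess (L := L) τ (ringCoord L P) + lam • (1 : Matrix ι ι ℝ))⁻¹ *ᵥ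
          frameGrad (L := L) τ (ringCoord L P)) j)) +
      χ (ringCoord L P) * ((1 / 2) * ((((frameHess (L := L) τ (ringCoord L P) + lam • (1 : Matrix ι ι ℝ))⁻¹ *ᵥ
          (fun k => frameD Y (fun M => frameGrad (L := L) τ M k) (ringCoord L P))) j) -
        (((frameHess (L := L) τ (ringCoord L P) + lam • (1 : Matrix ι ι ℝ))⁻¹ *ᵥ
          ((fun j' k => frameD Y (fun M => frameHess (L := L) τ M j' k) (ringCoord L P)) *ᵥ
            ((frameHess (L := L) τ (ringCoord L P) + lam • (1 : Matrix ι ι ℝ))⁻¹ *ᵥ frameGrad (L := L) τ (ringCoord L P)))) j))) := by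
  set c := fun s : ℝ => ringCoord L (P * multiCurve Y hY hY0 s) with hc
  have hc0 : c 0 = ringCoord L P := by simp [hc, multiCurve_zero]
  -- derivatives along the curve of `χ`, of the Hessian entries and of the gradient entries
  have hdχ : HasDerivAt (fun s => χ (c s)) (frameD Y χ (ringCoord L P)) 0 := by
    have h := hasDerivAt_comp_multiCurve hχ Y hY hY0 P 0
    rw [multiCurve_zero, mul_one] at h; exact h
  have hdH : ∀ j' k, HasDerivAt (fun s => (frameHess (L := L) τ (c s)) j' k)
      (frameD Y (fun M => frameHess (L := L) τ M j' k) (ringCoord L P)) 0 := by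
    intro j' k
    have h := hasDerivAt_comp_multiCurve (contDiff_frameHess (L := L) τ j' k) Y hY hY0 P 0
    rw [multiCurve_zero, mul_one] at h; exact h
  have hdg : ∀ k, HasDerivAt (fun s => frameGrad (L := L) τ (c s) k) (frameD Y (fun M => frameGrad (L := L) τ M k) (ringCoord L P)) 0 := by
    intro k
    have h := hasDerivAt_comp_multiCurve (contDiff_frameGrad (L := L) τ k) Y hY hY0 P 0
    rw [multiCurve_zero, mul_one] at h; exact h
  have hdet0 : (frameHess (L := L) τ (c 0) + lam • (1 : Matrix ι ι ℝ)).det ≠ 0 := by rw [hc0]; exact hdet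
  have hres := hasDerivAt_resolvent_coeff_of_det (Hs := fun s => frameHess (L := L) τ (c s)) (gs := fun s => frameGrad (L := L) τ (c s))
    (lam := lam) hdH hdg hdet0 j
  rw [hc0] at hres
  have hprod := hdχ.mul hres
  have hsmooth := contDiff_resolventCoeff (L := L) τ lam hχ hsupp j
  have h := frameD_eq_of_hasDerivAt hsmooth Y hY hY0 P (d := _) (by
    have e : (fun s => resolventCoeff (L := L) τ lam χ j (ringCoord L (P * multiCurve Y hY hY0 s))) =
        fun s => χ (c s) * ((1 / 2 : ℝ) * (((frameHess (L := L) τ (c s) + lam • (1 : Matrix ι ι ℝ))⁻¹ *ᵥ frameGrad (L := L) τ (c s)) j)) := by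
      funext s; rfl
    rw [e]; exact hprod)
  rw [h, hc0]

/-! ## §3 The divergence of the cut-off resolvent field -/

omit [Fintype ι] [DecidableEq ι] in
/-- The raw-minus-symmetrised Hessian is antisymmetric. [folklore] -/
theorem frameHessRaw_sub_frameHess_transpose (τ : ι → ((Fin (2 * L - 1 + 1) × Edge 3 L) ⊕ Site 3 L) → Matrix (Fin 2) (Fin 2) ℂ) (M : ((Fin (2 * L - 1 + 1) → Edge 3 L → Matrix (Fin 2) (Fin 2) ℂ) × (Site 3 L → Matrix (Fin 2) (Fin 2) ℂ))) :
    (frameHessRaw (L := L) τ M - frameHess (L := L) τ M)ᵀ = -(frameHessRaw (L := L) τ M - frameHess (L := L) τ M) := by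
  ext j k
  simp only [Matrix.transpose_apply, Matrix.sub_apply, Matrix.neg_apply, frameHess]
  ring

/-- ★★★ **The frame divergence of the cut-off resolvent field at a ring history**: with `M = ringCoord P`, `A = H + λ⋆`, `B_j = ∂_{τ_j}H`:
`Σ_j ∂_{τ_j}φ_j(M) = Σ_j ∂_{τ_j}χ(M)·½(A⁻¹g)_j + χ(M)·(½tr(A⁻¹H) − ½Σ_j (A⁻¹B_jA⁻¹g)_j)` (✓`sum_deriv_resolvent_coeff` with `N = Ĥ − H`).
[folklore] -/
theorem sum_frameD_resolventCoeff {τ : ι → ((Fin (2 * L - 1 + 1) × Edge 3 L) ⊕ Site 3 L) → Matrix (Fin 2) (Fin 2) ℂ} (hτ : ∀ j w, (τ j w)ᴴ = -τ j w) (hτ0 : ∀ j w, (τ j w).trace = 0)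
    (lam : ℝ) {χ : ((Fin (2 * L - 1 + 1) → Edge 3 L → Matrix (Fin 2) (Fin 2) ℂ) × (Site 3 L → Matrix (Fin 2) (Fin 2) ℂ)) → ℝ} (hχ : ContDiff ℝ ∞ χ)
    (hsupp : tsupport χ ⊆ {M : ((Fin (2 * L - 1 + 1) → Edge 3 L → Matrix (Fin 2) (Fin 2) ℂ) × (Site 3 L → Matrix (Fin 2) (Fin 2) ℂ)) | (frameHess (L := L) τ M + lam • (1 : Matrix ι ι ℝ)).det ≠ 0}) (P : ((Fin (2 * L - 1 + 1) → GaugeConfig 3 L SU2) × (Site 3 L → SU2)))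
    (hdet : (frameHess (L := L) τ (ringCoord L P) + lam • (1 : Matrix ι ι ℝ)).det ≠ 0) :
    ∑ j, frameD (τ j) (resolventCoeff (L := L) τ lam χ j) (ringCoord L P) =
      (∑ j, frameD (τ j) χ (ringCoord L P) * ((1 / 2) * (((frameHess (L := L) τ (ringCoord L P) + lam • (1 : Matrix ι ι ℝ))⁻¹ *ᵥ
          frameGrad (L := L) τ (ringCoord L P)) j))) +
      χ (ringCoord L P) * ((1 / 2) * Matrix.trace ((frameHess (L := L) τ (ringCoord L P) + lam • (1 : Matrix ι ι ℝ))⁻¹ *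
            frameHess (L := L) τ (ringCoord L P)) -
        (1 / 2) * ∑ j, ((frameHess (L := L) τ (ringCoord L P) + lam • (1 : Matrix ι ι ℝ))⁻¹ *ᵥ
          ((fun j' k => frameD (τ j) (fun M => frameHess (L := L) τ M j' k) (ringCoord L P)) *ᵥ
            ((frameHess (L := L) τ (ringCoord L P) + lam • (1 : Matrix ι ι ℝ))⁻¹ *ᵥ frameGrad (L := L) τ (ringCoord L P)))) j) := by
  set M := ringCoord L P with hM
  set H := frameHess (L := L) τ M with hH
  set N := frameHessRaw (L := L) τ M - frameHess (L := L) τ M with hN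
  have hHt : Hᵀ = H := frameHess_transpose τ M
  have hNt : Nᵀ = -N := frameHessRaw_sub_frameHess_transpose τ M
  -- each summand by `frameD_resolventCoeff`, with `∂_{τ_j} g = Ĥ_{j·} = (H + N)_{j·}`
  have hrow : ∀ j, (fun k => frameD (τ j) (fun M' => frameGrad (L := L) τ M' k) M) = fun k => H j k + N j k := by
    intro j; funext k
    rw [hN, Matrix.sub_apply, hH, add_sub_cancel]
    rfl
  have hsum := sum_deriv_resolvent_coeff hHt hNt lam (fun j => fun j' k => frameD (τ j) (fun M' => frameHess (L := L) τ M' j' k) M)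
    (frameGrad (L := L) τ M)
  have hterm : ∀ j, frameD (τ j) (resolventCoeff (L := L) τ lam χ j) M =
      frameD (τ j) χ M * ((1 / 2) * (((H + lam • (1 : Matrix ι ι ℝ))⁻¹ *ᵥ frameGrad (L := L) τ M) j)) +
      χ M * ((1 / 2) * ((((H + lam • (1 : Matrix ι ι ℝ))⁻¹ *ᵥ (fun k => H j k + N j k)) j) -
        (((H + lam • (1 : Matrix ι ι ℝ))⁻¹ *ᵥ ((fun j' k => frameD (τ j) (fun M' => frameHess (L := L) τ M' j' k) M) *ᵥ
          ((H + lam • (1 : Matrix ι ι ℝ))⁻¹ *ᵥ frameGrad (L := L) τ M))) j))) := by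
    intro j
    rw [← hrow j]
    exact frameD_resolventCoeff τ lam hχ hsupp (τ j) (hτ j) (hτ0 j) P hdet j
  simp only [hterm, Finset.sum_add_distrib, ← Finset.mul_sum]
  rw [← Finset.mul_sum] at hsum
  rw [hsum]

/-- ★ Off the topological support of the cut-off every frame derivative of every coefficient vanishes (so the divergence is `0` there). [folklore] -/
theorem frameD_resolventCoeff_eq_zero_of_notMem (τ : ι → ((Fin (2 * L - 1 + 1) × Edge 3 L) ⊕ Site 3 L) → Matrix (Fin 2) (Fin 2) ℂ) (lam : ℝ) (χ : ((Fin (2 * L - 1 + 1) → Edge 3 L → Matrix (Fin 2) (Fin 2) ℂ) × (Site 3 L → Matrix (Fin 2) (Fin 2) ℂ)) → ℝ) {M : ((Fin (2 * L - 1 + 1) → Edge 3 L → Matrix (Fin 2) (Fin 2) ℂ) × (Site 3 L → Matrix (Fin 2) (Fin 2) ℂ))}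
    (hM : M ∉ tsupport χ) (Y : ((Fin (2 * L - 1 + 1) × Edge 3 L) ⊕ Site 3 L) → Matrix (Fin 2) (Fin 2) ℂ) (j : ι) :
    frameD Y (resolventCoeff (L := L) τ lam χ j) M = 0 := by
  have h0 : χ =ᶠ[𝓝 M] 0 := notMem_tsupport_iff_eventuallyEq.1 hM
  have hev : resolventCoeff (L := L) τ lam χ j =ᶠ[𝓝 M] fun _ => 0 := by
    filter_upwards [h0] with M' hM'
    rw [resolventCoeff, hM', Pi.zero_apply, zero_mul]
  rw [frameD, hev.fderiv_eq, fderiv_const_apply]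
  simp

end Summit.QuantumFields.YangMills.Theorems.VirialFluxGap.FrameHessian

end
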